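import Summits.ResolutionOfSingularities.ResolutionOfSingularities.Theorems.EquisingularLiftEquisingularLiftProjectiveAmbientFibre
import Summits.ResolutionOfSingularities.ResolutionOfSingularities.Theorems.EquisingularLiftEquisingularLiftProjectiveAmbientSmoothProper
import Literature.AlgebraicGeometry.Resolution.ProjHomogeneousIdealSheaf
import Literature.AlgebraicGeometry.Resolution.MarkedIdealsLemmas
import Literature.RingTheory.MvPolynomial.VariableIdeals
import HarnessLib

/-!
# `EquisingularLift` (stmt-ResolutionOfSingularities-15660), line `Sketch` v10 — the coordinate linear subspace as a centre:
# algebra of the kill map and its base change to the special fibre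

[OURS · L1 W4.5b] Helper for the registered stub `stub_EL_of_blowupModel` of the crux `EquisingularLift`; NOT a statement of
any manuscript.

The coordinate linear subspace `Λ = V(x_{r+1}, …, x_{r+m}) ⊆ ℙ^{r+m}_R` is carried, def-free, as the kernel ideal sheaf
`ker (Proj f)` of `Proj` of a graded ring homomorphism `f : R[x_0..x_{r+m}] → R[x_0..x_r]` with `f (C a) = C a` and
`f (x_i) = x_i` (`i ≤ r`), `f (x_i) = 0` (`i > r`) — the graded surjection killing the last `m` variables. This file:

* `kill_rename`, `kill_surjective`, `ker_kill` — renaming along `Fin (r+1) ↪ Fin (r+m+1)` is a section, `f` is surjective,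
  `ker f = (x_i : i > r)` (via `Literature.RingTheory.MvPolynomial.ker_aeval_ite_eq_span`); `isHomogeneous_kill`,
  `irrelevant_le_map_kill` (the hypothesis of Mathlib's `Proj.map`);
* `map_comp_kill`, `exists_homogeneous_lift`, `exists_ker_lift` — compatibility with a coefficient map `π : O → k` and
  lifting of homogeneous kernel elements along a surjective `π`;
* `comap_ker_projMap_kill` — for the closed immersion `g = Proj (map π) : ℙ^{r+m}_k → ℙ^{r+m}_O` onto the special
  fibre (`π : O → k` surjective), `ker (Proj f_O) · 𝒪_{ℙ_k} = ker (Proj f_k)` (Hartshorne II Prop. 5.9 / Ex. 3.12 on the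
  charts `D₊(x_i)`, tree `ker_projMap_ideal_basicOpen`, `ideal_comap_of_le`).
-/

set_option linter.dupNamespace false -- mandated namespace `Summit.<Summit>.<Problem>` of this single-conjunct summit
set_option linter.overlappingInstances false -- signatures carry `[IsDomain O] [IsDiscreteValuationRing O]`

noncomputable section

open CategoryTheory CategoryTheory.Limits AlgebraicGeometry TopologicalSpace
open MvPolynomial HomogeneousLocalization
open Literature.AlgebraicGeometry.Resolution
open AlgebraicGeometry.Scheme.IdealSheafData

attribute [local instance] MvPolynomial.gradedAlgebra
attribute [local instance] Literature.AlgebraicGeometry.Motives.ProjBaseChange.algebraBase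

namespace Summit.ResolutionOfSingularities.ResolutionOfSingularities.Cruxes.EquisingularLift.StrataSplit

namespace LinearCentre

universe u

/-! ## Algebra of the graded surjection killing the last `m` variables -/

section Kill

variable {R : Type u} [CommRing R] {r m : ℕ}
  (f : MvPolynomial (Fin (r + m + 1)) R →+* MvPolynomial (Fin (r + 1)) R)
  (hfC : ∀ a : R, f (C a) = C a)
  (hfX : ∀ i : Fin (r + m + 1), f (X i) = if h : (i : ℕ) < r + 1 then X ⟨i, h⟩ else 0)

/-- The inequality `r + 1 ≤ r + m + 1`. [folklore] -/
theorem le_rm (r m : ℕ) : r + 1 ≤ r + m + 1 := by omega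

include hfC hfX in
/-- Killing the last `m` variables after renaming along `Fin (r+1) ↪ Fin (r+m+1)` is the identity (a section).
[folklore] -/
theorem kill_rename (q : MvPolynomial (Fin (r + 1)) R) : f (rename (Fin.castLE (le_rm r m)) q) = q := by
  have h : f.comp (rename (Fin.castLE (le_rm r m)) : MvPolynomial (Fin (r + 1)) R →ₐ[R] _).toRingHom =
      RingHom.id _ := by
    refine MvPolynomial.ringHom_ext (fun a => ?_) (fun j => ?_)
    · simp only [RingHom.coe_comp, Function.comp_apply, AlgHom.toRingHom_eq_coe, RingHom.coe_coe, rename_C,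
        RingHom.id_apply]
      exact hfC a
    · simp only [RingHom.coe_comp, Function.comp_apply, AlgHom.toRingHom_eq_coe, RingHom.coe_coe, rename_X,
        RingHom.id_apply]
      rw [hfX]
      have hj : ((Fin.castLE (le_rm r m) j : Fin (r + m + 1)) : ℕ) < r + 1 := j.2
      rw [dif_pos hj]
      congr 1
  exact congrArg (fun g : MvPolynomial (Fin (r + 1)) R →+* _ => g q) h

include hfC hfX in
/-- The kill map is surjective. [folklore] -/
theorem kill_surjective : Function.Surjective f :=
  fun q => ⟨_, kill_rename f hfC hfX q⟩

include hfC hfX in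
/-- **The kernel of the kill map is the ideal of the killed variables** `(x_i : r + 1 ≤ i)`. [folklore] -/
theorem ker_kill : RingHom.ker f = Ideal.span (X '' {i : Fin (r + m + 1) | r + 1 ≤ (i : ℕ)}) := by
  classical
  -- the kill map followed by the (injective) renaming is the endomorphism `x_i ↦ 0 (i > r), x_i ↦ x_i`
  set s : Set (Fin (r + m + 1)) := {i | r + 1 ≤ (i : ℕ)} with hs
  have hcomp : (aeval (fun i : Fin (r + m + 1) => if i ∈ s then (0 : MvPolynomial (Fin (r + m + 1)) R) else X i)
      : MvPolynomial (Fin (r + m + 1)) R →ₐ[R] _).toRingHom =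
      (rename (Fin.castLE (le_rm r m)) : MvPolynomial (Fin (r + 1)) R →ₐ[R] _).toRingHom.comp f := by
    refine MvPolynomial.ringHom_ext (fun a => ?_) (fun i => ?_)
    · simp only [AlgHom.toRingHom_eq_coe, RingHom.coe_coe, aeval_C, RingHom.coe_comp, Function.comp_apply,
        MvPolynomial.algebraMap_eq]
      rw [hfC, rename_C]
    · simp only [AlgHom.toRingHom_eq_coe, RingHom.coe_coe, aeval_X, RingHom.coe_comp, Function.comp_apply]
      rw [hfX]
      by_cases hi : (i : ℕ) < r + 1
      · have his : i ∉ s := fun h => by simp only [hs, Set.mem_setOf_eq] at h; omega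
        rw [if_neg his, dif_pos hi, rename_X]
        congr 1
      · have his : i ∈ s := by simp only [hs, Set.mem_setOf_eq]; omega
        rw [if_pos his, dif_neg hi, map_zero]
  rw [← Literature.RingTheory.MvPolynomial.ker_aeval_ite_eq_span s]
  ext q
  simp only [RingHom.mem_ker]
  have happ := congrArg (fun g : MvPolynomial (Fin (r + m + 1)) R →+* _ => g q) hcomp
  simp only [AlgHom.toRingHom_eq_coe, RingHom.coe_coe, RingHom.coe_comp, Function.comp_apply] at happ
  rw [happ]
  constructor
  · intro h
    rw [h, map_zero]
  · intro h
    exact rename_injective _ (Fin.castLE_injective (le_rm r m)) (by rw [h, map_zero])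

include hfX in
/-- The kill map preserves homogeneity (all variables go to forms of degree one or to zero). [folklore] -/
theorem isHomogeneous_kill (hfC : ∀ a : R, f (C a) = C a) {q : MvPolynomial (Fin (r + m + 1)) R} {n : ℕ}
    (hq : q.IsHomogeneous n) : (f q).IsHomogeneous n := by
  have hf : f = (aeval fun i : Fin (r + m + 1) =>
      if h : (i : ℕ) < r + 1 then (X ⟨i, h⟩ : MvPolynomial (Fin (r + 1)) R) else 0).toRingHom := by
    refine MvPolynomial.ringHom_ext (fun a => ?_) (fun i => ?_)
    · rw [hfC]; simp
    · rw [hfX]; simp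
  rw [hf]
  have h1 := hq.aeval (fun i : Fin (r + m + 1) =>
      if h : (i : ℕ) < r + 1 then (X ⟨i, h⟩ : MvPolynomial (Fin (r + 1)) R) else 0) (n := 1) (fun i => by
    by_cases h : (i : ℕ) < r + 1
    · rw [dif_pos h]; exact isHomogeneous_X R _
    · rw [dif_neg h]; exact isHomogeneous_zero _ _ _)
  rw [one_mul] at h1
  exact h1

include hfC hfX in
/-- The irrelevant ideal of the target is generated by the image of the irrelevant ideal of the source (the
hypothesis of Mathlib's `Proj.map`), for the kill map viewed as a graded homomorphism. [folklore] -/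
theorem irrelevant_le_map_kill (g : homogeneousSubmodule (Fin (r + m + 1)) R →+*ᵍ homogeneousSubmodule (Fin (r + 1)) R)
    (hg : ∀ q, g q = f q) :
    HomogeneousIdeal.irrelevant (homogeneousSubmodule (Fin (r + 1)) R) ≤
      (HomogeneousIdeal.irrelevant (homogeneousSubmodule (Fin (r + m + 1)) R)).map g := by
  rw [← toIdeal_le_toIdeal_iff, HomogeneousIdeal.toIdeal_map]
  refine (irrelevant_le_span r R).trans (Ideal.span_le.mpr ?_)
  rintro _ ⟨j, rfl⟩
  have hXj : (X j : MvPolynomial (Fin (r + 1)) R) = g (X (Fin.castLE (le_rm r m) j)) := by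
    rw [hg, ← rename_X (Fin.castLE (le_rm r m)) j, kill_rename f hfC hfX]
  rw [SetLike.mem_coe, hXj]
  exact Ideal.mem_map_of_mem _ (HomogeneousIdeal.mem_irrelevant_of_mem _ one_pos (isHomogeneous_X R _))

end Kill

/-! ## Base change of the kill map along `π : O → k` -/

section Square

variable {O k : Type u} [CommRing O] [CommRing k] (π : O →+* k) {r m : ℕ}
  (fO : MvPolynomial (Fin (r + m + 1)) O →+* MvPolynomial (Fin (r + 1)) O)
  (hfOC : ∀ a : O, fO (C a) = C a)
  (hfOX : ∀ i : Fin (r + m + 1), fO (X i) = if h : (i : ℕ) < r + 1 then X ⟨i, h⟩ else 0)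
  (fk : MvPolynomial (Fin (r + m + 1)) k →+* MvPolynomial (Fin (r + 1)) k)
  (hfkC : ∀ a : k, fk (C a) = C a)
  (hfkX : ∀ i : Fin (r + m + 1), fk (X i) = if h : (i : ℕ) < r + 1 then X ⟨i, h⟩ else 0)

include hfOC hfOX hfkC hfkX in
/-- The kill maps over `O` and over `k` commute with the coefficient map `π`. [folklore] -/
theorem map_comp_kill : (MvPolynomial.map π).comp fO = fk.comp (MvPolynomial.map π) := by
  refine MvPolynomial.ringHom_ext (fun a => ?_) (fun i => ?_)
  · simp only [RingHom.coe_comp, Function.comp_apply]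
    rw [hfOC, map_C, map_C, hfkC]
  · simp only [RingHom.coe_comp, Function.comp_apply]
    rw [hfOX, map_X, hfkX]
    by_cases h : (i : ℕ) < r + 1
    · rw [dif_pos h, dif_pos h, map_X]
    · rw [dif_neg h, dif_neg h, map_zero]

/-- A homogeneous polynomial over `k` lifts along a surjection `π : O → k` to a homogeneous polynomial over `O` of
the same degree. [folklore] -/
theorem exists_homogeneous_lift (hπ : Function.Surjective π) {σ : Type*} {n : ℕ} (a : MvPolynomial σ k)
    (ha : a.IsHomogeneous n) : ∃ b : MvPolynomial σ O, b.IsHomogeneous n ∧ MvPolynomial.map π b = a := by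
  classical
  refine ⟨∑ d ∈ a.support, monomial d (Function.surjInv hπ (coeff d a)), ?_, ?_⟩
  · refine IsHomogeneous.sum _ _ _ fun d hd => isHomogeneous_monomial _ ?_
    rw [Finsupp.degree_eq_weight_one]
    exact ha (mem_support_iff.mp hd)
  · rw [map_sum]
    simp only [map_monomial, Function.surjInv_eq hπ]
    exact (as_sum a).symm

include hfOC hfOX hfkC hfkX in
/-- **Kernel elements lift**: a homogeneous element of `ker f_k` lifts along `π` (surjective) to a homogeneous element of
`ker f_O` of the same degree (lift arbitrarily, then subtract the renamed kill). [folklore] -/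
theorem exists_ker_lift (hπ : Function.Surjective π) {n : ℕ} (a : MvPolynomial (Fin (r + m + 1)) k)
    (ha : a.IsHomogeneous n) (hak : fk a = 0) :
    ∃ b : MvPolynomial (Fin (r + m + 1)) O, b.IsHomogeneous n ∧ fO b = 0 ∧ MvPolynomial.map π b = a := by
  obtain ⟨b, hb, hba⟩ := exists_homogeneous_lift π hπ a ha
  refine ⟨b - rename (Fin.castLE (le_rm r m)) (fO b), ?_, ?_, ?_⟩
  · exact hb.sub ((isHomogeneous_kill fO hfOX hfOC hb).rename_isHomogeneous)
  · rw [map_sub, kill_rename fO hfOC hfOX, sub_self]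
  · rw [map_sub, hba, map_rename, sub_eq_self]
    have h := congrArg (fun g : MvPolynomial (Fin (r + m + 1)) O →+* _ => g b) (map_comp_kill π fO hfOC hfOX fk hfkC hfkX)
    simp only [RingHom.coe_comp, Function.comp_apply] at h
    rw [h, hba, hak, map_zero]

end Square

/-! ## The kernel ideal sheaf of the linear subspace: base change to the special fibre -/

section Comap

variable {O k : Type} [CommRing O] [CommRing k] (π : O →+* k) (hπ : Function.Surjective π) {r m : ℕ}


variable (φ : (homogeneousSubmodule (Fin (r + m + 1)) O) →+*ᵍ (homogeneousSubmodule (Fin (r + m + 1)) k)) (hφ : ∀ q, φ q = MvPolynomial.map π q)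
  (hφ' : HomogeneousIdeal.irrelevant (homogeneousSubmodule (Fin (r + m + 1)) k) ≤ (HomogeneousIdeal.irrelevant (homogeneousSubmodule (Fin (r + m + 1)) O)).map φ)
  (fO : (homogeneousSubmodule (Fin (r + m + 1)) O) →+*ᵍ (homogeneousSubmodule (Fin (r + 1)) O)) (hfO' : HomogeneousIdeal.irrelevant (homogeneousSubmodule (Fin (r + 1)) O) ≤ (HomogeneousIdeal.irrelevant (homogeneousSubmodule (Fin (r + m + 1)) O)).map fO)
  (hfOC : ∀ a : O, fO (C a) = C a)
  (hfOX : ∀ i : Fin (r + m + 1), fO (X i) = if h : (i : ℕ) < r + 1 then X ⟨i, h⟩ else 0)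
  (fk : (homogeneousSubmodule (Fin (r + m + 1)) k) →+*ᵍ (homogeneousSubmodule (Fin (r + 1)) k)) (hfk' : HomogeneousIdeal.irrelevant (homogeneousSubmodule (Fin (r + 1)) k) ≤ (HomogeneousIdeal.irrelevant (homogeneousSubmodule (Fin (r + m + 1)) k)).map fk)
  (hfkC : ∀ a : k, fk (C a) = C a)
  (hfkX : ∀ i : Fin (r + m + 1), fk (X i) = if h : (i : ℕ) < r + 1 then X ⟨i, h⟩ else 0)

/-- `Proj.map` does not depend on the presentation of the graded ring map. [folklore] -/
theorem projMap_congr' {A B σ τ : Type} [CommRing A] [CommRing B] [SetLike σ A] [AddSubgroupClass σ A]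
    [SetLike τ B] [AddSubgroupClass τ B] {𝒜 : ℕ → σ} {ℬ : ℕ → τ} [GradedRing 𝒜] [GradedRing ℬ]
    {f g : 𝒜 →+*ᵍ ℬ} (h : f = g) (hf : HomogeneousIdeal.irrelevant ℬ ≤ (HomogeneousIdeal.irrelevant 𝒜).map f)
    (hg : HomogeneousIdeal.irrelevant ℬ ≤ (HomogeneousIdeal.irrelevant 𝒜).map g) :
    Proj.map f hf = Proj.map g hg := by
  subst h
  rfl

include hφ hfOC hfOX hfkC hfkX hπ in
/-- **The `O`-linear centre restricts to the `k`-linear centre on the special fibre**: for the closed immersion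
`g = Proj φ : ℙ^{r+m}_k → ℙ^{r+m}_O` (`φ` the coefficient map of a surjection `π : O → k`) and the kill maps `f_O`,
`f_k`, the inverse image ideal sheaf of `ker (Proj f_O)` along `g` is `ker (Proj f_k)`. (`≤`: `Proj f_k ≫ g =
Proj φ_r ≫ Proj f_O`; `≥`: over the chart `D₊(x_i)` the ideal `(ker f_k)_{(x_i)}` is spanned by fractions
`a/x_iⁿ`, `a ∈ ker f_k` homogeneous, which lift to `ker f_O`.) [folklore] -/
theorem comap_ker_projMap_kill :
    (Proj.map fO hfO').ker.comap (Proj.map φ hφ') = (Proj.map fk hfk').ker := by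
  classical
  -- the coefficient map on the small projective space
  let φr : (homogeneousSubmodule (Fin (r + 1)) O) →+*ᵍ (homogeneousSubmodule (Fin (r + 1)) k) := ⟨MvPolynomial.map π, fun h ↦ h.map π⟩
  have hφr : ∀ q, φr q = MvPolynomial.map π q := fun _ ↦ rfl
  have hφr' := ProjectiveAmbientFibre.irrelevant_le_map_gradedMap π φr hφr
  have hsq : fk.comp φ = φr.comp fO := by
    have hc := map_comp_kill π fO.toRingHom (fun a => hfOC a) (fun i => hfOX i) fk.toRingHom (fun a => hfkC a)
      (fun i => hfkX i)
    refine GradedRingHom.ext fun q => ?_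
    have h := congrArg (fun ψ : MvPolynomial (Fin (r + m + 1)) O →+* MvPolynomial (Fin (r + 1)) k => ψ q) hc
    simp only [RingHom.coe_comp, Function.comp_apply] at h
    rw [GradedRingHom.comp_apply, GradedRingHom.comp_apply, hφ, hφr]
    exact h.symm
  refine le_antisymm ?_ ?_
  · -- `≤`: formal, from `Proj f_k ≫ g = Proj φ_r ≫ Proj f_O`
    refine le_map_iff_comap_le.mp ?_
    rw [map_ker, ← Proj.map_comp φ fk hφ' hfk',
      projMap_congr' hsq (HomogeneousIdeal.irrelevant_le_map_comp hφ' hfk') (HomogeneousIdeal.irrelevant_le_map_comp hfO' hφr'),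
      Proj.map_comp fO φr hfO' hφr']
    exact Scheme.Hom.le_ker_comp _ _
  · -- `≥`: chartwise on the cover `D₊(φ x_i) = D₊(x_i)` of `ℙ_k`
    have hXO : ∀ i : Fin (r + m + 1), (X i : MvPolynomial (Fin (r + m + 1)) O) ∈ (homogeneousSubmodule (Fin (r + m + 1)) O) 1 := fun i => isHomogeneous_X O i
    have hXk : ∀ i : Fin (r + m + 1), φ (X i) ∈ (homogeneousSubmodule (Fin (r + m + 1)) k) 1 := fun i => φ.map_mem (hXO i)
    let U : Fin (r + m + 1) → (Proj (homogeneousSubmodule (Fin (r + m + 1)) k)).affineOpens := fun i =>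
      ⟨Proj.basicOpen (homogeneousSubmodule (Fin (r + m + 1)) k) (φ (X i)), Proj.isAffineOpen_basicOpen (homogeneousSubmodule (Fin (r + m + 1)) k) (φ (X i)) (hXk i) one_pos⟩
    have hU : ⨆ i, (U i : (Proj (homogeneousSubmodule (Fin (r + m + 1)) k)).Opens) = ⊤ := by
      have h := Proj.iSup_basicOpen_eq_top (homogeneousSubmodule (Fin (r + m + 1)) k) (fun i : Fin (r + m + 1) => (X i : MvPolynomial (Fin (r + m + 1)) k))
        (irrelevant_le_span (r + m) k)
      have hfun : (fun i => (U i : (Proj (homogeneousSubmodule (Fin (r + m + 1)) k)).Opens)) = fun i => Proj.basicOpen (homogeneousSubmodule (Fin (r + m + 1)) k) (X i) := by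
        funext i
        change Proj.basicOpen (homogeneousSubmodule (Fin (r + m + 1)) k) (φ (X i)) = Proj.basicOpen (homogeneousSubmodule (Fin (r + m + 1)) k) (X i)
        rw [hφ, map_X]
      change iSup (fun i => (U i : (Proj (homogeneousSubmodule (Fin (r + m + 1)) k)).Opens)) = ⊤
      rw [hfun]
      exact h
    refine le_of_iSup_eq_top U hU fun i => ?_
    let UO : (Proj (homogeneousSubmodule (Fin (r + m + 1)) O)).affineOpens := ⟨Proj.basicOpen (homogeneousSubmodule (Fin (r + m + 1)) O) (X i), Proj.isAffineOpen_basicOpen (homogeneousSubmodule (Fin (r + m + 1)) O) (X i) (hXO i) one_pos⟩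
    have hle : (U i : (Proj (homogeneousSubmodule (Fin (r + m + 1)) k)).Opens) ≤ Proj.map φ hφ' ⁻¹ᵁ (UO : (Proj (homogeneousSubmodule (Fin (r + m + 1)) O)).Opens) := by
      change Proj.basicOpen (homogeneousSubmodule (Fin (r + m + 1)) k) (φ (X i)) ≤ Proj.map φ hφ' ⁻¹ᵁ Proj.basicOpen (homogeneousSubmodule (Fin (r + m + 1)) O) (X i)
      rw [Proj.map_preimage_basicOpen]
    have hsurjk : Function.Surjective fk :=
      kill_surjective fk.toRingHom (fun a => hfkC a) (fun i => hfkX i)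
    have hsurjO : Function.Surjective fO :=
      kill_surjective fO.toRingHom (fun a => hfOC a) (fun i => hfOX i)
    rw [ker_projMap_ideal_basicOpen fk hfk' hsurjk one_pos (hXk i),
      ideal_comap_of_le (Proj.map φ hφ') (Proj.map fO hfO').ker UO (U i) hle,
      ker_projMap_ideal_basicOpen fO hfO' hsurjO one_pos (hXO i)]
    -- generators `a / (φ x_i)ⁿ` with `a ∈ ker f_k` homogeneous
    unfold awayIdeal
    rw [Ideal.map_span]
    refine Ideal.span_le.mpr ?_
    rintro _ ⟨x, ⟨n, a, ha, hak, rfl⟩, rfl⟩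
    have ha1 : a.IsHomogeneous n := by simpa [smul_eq_mul] using ha
    have hak0 : fk.toRingHom a = 0 := RingHom.mem_ker.mp hak
    obtain ⟨b, hb, hbO, hba⟩ := exists_ker_lift π fO.toRingHom (fun a => hfOC a) (fun i => hfOX i)
      fk.toRingHom (fun a => hfkC a) (fun i => hfkX i) hπ a ha1 hak0
    have hbO' : b ∈ RingHom.ker fO := RingHom.mem_ker.mpr hbO
    have hbn : b ∈ (homogeneousSubmodule (Fin (r + m + 1)) O) (n • 1) := by simpa [smul_eq_mul] using hb
    -- the upstairs section `b / x_iⁿ` lies in the kernel ideal and maps to `a / (φ x_i)ⁿ`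
    have hup : (Proj.awayToSection (homogeneousSubmodule (Fin (r + m + 1)) O) (X i)).hom (Away.mk (homogeneousSubmodule (Fin (r + m + 1)) O) (hXO i) n b hbn) ∈
        Ideal.map (Proj.awayToSection (homogeneousSubmodule (Fin (r + m + 1)) O) (X i)).hom (awayIdeal (homogeneousSubmodule (Fin (r + m + 1)) O) (hXO i) (RingHom.ker fO)) :=
      Ideal.mem_map_of_mem _ (mk_mem_awayIdeal (homogeneousSubmodule (Fin (r + m + 1)) O) (hXO i) hbn hbO')
    have himg : ((Proj.map φ hφ').appLE (UO : (Proj (homogeneousSubmodule (Fin (r + m + 1)) O)).Opens) (U i : (Proj (homogeneousSubmodule (Fin (r + m + 1)) k)).Opens) hle).hom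
        ((Proj.awayToSection (homogeneousSubmodule (Fin (r + m + 1)) O) (X i)).hom (Away.mk (homogeneousSubmodule (Fin (r + m + 1)) O) (hXO i) n b hbn)) =
        (Proj.awayToSection (homogeneousSubmodule (Fin (r + m + 1)) k) (φ (X i))).hom (Away.mk (homogeneousSubmodule (Fin (r + m + 1)) k) (hXk i) n a ha) := by
      have h := congrArg (fun ψ => ψ.hom (Away.mk (homogeneousSubmodule (Fin (r + m + 1)) O) (hXO i) n b hbn)) (Proj.awayToSection_comp_appLE φ hφ' (hXO i))
      simp only [CommRingCat.hom_comp, RingHom.comp_apply, CommRingCat.hom_ofHom] at h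
      rw [h, Away.map_mk]
      congr 1
      apply val_injective
      simp only [Away.val_mk]
      congr 1
      rw [hφ, hba]
    rw [SetLike.mem_coe, ← himg]
    exact Ideal.mem_map_of_mem _ hup

end Comap


end LinearCentre

end Summit.ResolutionOfSingularities.ResolutionOfSingularities.Cruxes.EquisingularLift.StrataSplit

end
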